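import Summits.QuantumFields.BalabanUV.T4Continuum.Support.ShellMeasureCellGaugeFromPlaquettes
import Summits.QuantumFields.BalabanUV.Beta.AdjointCarrierWiringEnd

/-!
# `T4Continuum.ShellMeasureCellGaugeFromPlaquettesAd` — ROW S119 = J4, FILE 2: THE ADJOINT-CARRIER STEP BY NAME — for a `U(N)`-valued
# torus background the `Beta/` END `decay_levelOp_cov` fires on its COMPONENT transporters `Rm := adMat ∘ U` from «every in-cell
# plaquette `U(∂p)` is within `α_k` of `1`», scale-free under `2·S_k²·α_k ≤ α₀`
(cell `pub-balaban`, sub-cell `t4`, spine estimate NE7c (node U5b); NE7c ROUND-2 crew `t4-ne7c-formalise-*`, unit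
`b2b-balaban-t4-ne7c-formalise-leaf-01` gen 12; ROW S119 = J4 of the owner's table `t4/b2b-balaban-t4-ne7c-p1/LEAVES-NE7c-P1.md`, RULING
R-ne7cp1-g37-8 (d) «wire `CovariantBoxPoincareBlocks.hHol_of_hdef` + `CovariantPlateauBlocks.hdef_le_of_plaqW` + THE ADJOINT-CARRIER STEP
BY NAME»; file 1 `ShellMeasureCellGaugeFromPlaquettes` did the first two for ANY orthogonal `Rm`; THIS file is the third; ADDITIVE —
imports file 1 + `Beta.AdjointCarrierWiringEnd` (b2b-balaban-beta-d4-p3 gen 8: `CompFamily`, `adMat`, `Wad`, `hplaqW_Wad_of_plaq`) ONLY,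
everything BY NAME; touches NO host, moves NO census row; [folklore]; three [our object] data defs (`adRm`, `cellCfg`, `cellPlaqU`),
0 `def … : Prop`, 0 sorry, 0 citation tags of ours)

HONEST FRAMING.  Finite four-torus programme, rung (B)+1 only — NOT infinite volume, NOT a mass gap, NOT the Clay problem, NOT summit
progress; (B), `BetaPertHyp`, (B^μ) not consumed and NOT discharged.  NE7c (`T4IndicatorShell.ShellWeightBound`) is NOT PRINTED in
[Balaban 1983–89] and NOT PROVED; «NE7c ⇐ the named binders» (trigger c3).  Lattice∕linear-algebra bookkeeping about the `Beta/` MODEL: a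
`unitaryUnits (Matrix n n ℂ)`-valued torus field `U` as DATA, its adjoint components through a trace-orthonormal hermitian component
family (`CompFamily`, DATA — e.g. su(2)∕Pauli), nothing of Bałaban's instantiated, asserted, cited or discharged.  [Balaban1985Background
Propagators] (3.19) p. 393, (3.35) p. 396 and [Balaban1985Averaging] (44)∕(57) pp. 24∕27 are LOCATORS of SHAPES whose `[cite:]` tags live
in the imported `Beta/` modules (ABSOLUTE RULE).  HONEST DEPENDENCY (cell): continuum YM on T⁴ ⇐ BetaPertH ∧ nine spine estimates (0/9
proved); BetaPertH ⇐ (D1) ∧ (D4) ∧ CAP+tail; G-an2-4 gates asym, D1 and NE2/3/4.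

CONTENT (kernel, 0 sorry).  §1 `adRm U b := adMat c e ↑(U b)` (the component background) is orthogonal in THE END's column form
(`adRm_orth`, from `AdjointCarrierWiring.adMat_transpose_mul_self`); the cell configuration `cellCfg k : Unit → Site d → Fin d → units`
(cell `k`'s bond variables read on `ℤ^d` through `toOff`, for b07's `hol`) with **`cellW_adRm`**: file 1's one-block carrier of `adRm U`
IS d4-p3's `Wad (cellCfg k)`; the in-cell unit plaquette `cellPlaqU k v κ μ = U(x,κ)·U(x⁺κ,μ)·U(x⁺μ,κ)⁻¹·U(x,μ)⁻¹` (chart form) with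
**`hol_cellCfg_plaqWord`** (b07's plaquette holonomy of `cellCfg k` at `emb v` IS it).  §1b the field hypothesis in b07's BOX
currency: **`hplaqU_of_plaqIn`** (every `PlaqIn 0 (S−1)` plaquette within `α` ⟹ every chart plaquette) and **`hplaqU_of_pdevOn`**
(`pdevOn 0 (S−1) (cellCfg k ()) ≤ α` — OUR row E7's functional `B7Prop1Local.pdevOn` applied to the cell configuration — suffices).  §2 **`hplaq_adRm_of_plaqU`**: file 1's
`hplaq` for `adRm U` with constant `2α` from `‖cellPlaqU − 1‖ ≤ α` (`hplaqW_Wad_of_plaq` BY NAME); **`hgauge_adRm_of_plaqU`**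
(THE END's `hgauge k`, `ε_k = d(S_k − 1)·(2α_k)`).  §3 THE END FIRED ON THE ADJOINT CARRIER: **`decay_levelOp_cov_of_plaquettesU`** =
file 1's `decay_levelOp_cov_of_plaquettes` at `Rm := adRm U`, `α_k := 2α_k^U`, `θ = 8d⁴α₀²` under `S_k²·(2α_k^U) ≤ α₀`.  §4 G-1:
su(2)∕Pauli, the flat `U(2)` field on the one-cell d = 2 torus — `hplaq_adRm_of_plaqU` FIRED at `α = 0`.
WHAT THIS FILE DOES NOT DO.  It does not choose Bałaban's background (`Ubg V` of THE ONE CALL lives on b07's `ℤ^d` boxes with an abstract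
`𝔸`; reading it as a torus field per slot and E7's `pdevOn` as `‖cellPlaqU − 1‖ ≤ α` is node O's dictionary), nor the cells (J2), nor
the normalisation (J1).  E7 stays displayed; NOTHING in the countdown moves; NE7c NOT PROVED; spine PROVED 0∕9.
-/

noncomputable section

open scoped BigOperators Matrix Matrix.Norms.L2Operator
open Finset Function

namespace Summit.QuantumFields.BalabanUV.T4Continuum.ShellMeasureCellGaugeFromPlaquettesAd

open Summit.QuantumFields.BalabanUV.Beta
open Summit.QuantumFields.BalabanUV.Beta.BoxPoincare (Box)
open Summit.QuantumFields.BalabanUV.Beta.CovariantBoxPoincare (hol succ)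
open Summit.QuantumFields.BalabanUV.Beta.MultiscaleCoerciveTorus
open Summit.QuantumFields.BalabanUV.Beta.MultiscaleDistance
open Summit.QuantumFields.BalabanUV.Beta.MultiscaleDecayBudget (siteScale)
open Summit.QuantumFields.BalabanUV.Beta.ThinLoopHolonomy (cpxHom)
open Summit.QuantumFields.BalabanUV.Beta.CovariantPlateauBlocks (Off BSite Bond plaqW succOff emb toOff toOff_emb emb_succOff)
open Summit.QuantumFields.BalabanUV.Beta.AdjointCarrierWiring (adMat adMat_transpose_mul_self)
open Summit.QuantumFields.BalabanUV.Beta.AdjointCarrierWiringEnd (CompFamily compFamily_pauli Wad Wad_apply hplaqW_Wad_of_plaq)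
open Summit.QuantumFields.BalabanUV.T4Continuum.ShellMeasureCellGaugeFromPlaquettes
open Literature.MathematicalPhysics.QuantumFieldTheory.Balaban1983to89
open Literature.MathematicalPhysics.QuantumFieldTheory.Balaban1983to89.B7Prop1Explicit (Site plaqWord)
open Literature.MathematicalPhysics.QuantumFieldTheory.Balaban1983to89.B7Prop1Local (hol_plaqWord_eq)
open Literature.MathematicalPhysics.QuantumFieldTheory.Balaban1983to89.B7Prop2Explicit (unitaryUnits mem_unitaryUnits)
open Literature.MathematicalPhysics.QuantumFieldTheory.Balaban1983to89.B9AdOrthogonal (pauli)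
open Literature.MathematicalPhysics.QuantumFieldTheory.Balaban1983to89.B9Thm37GluePU (bsrc btgt)
open Literature.MathematicalPhysics.QuantumFieldTheory.Balaban1983to89.B9Thm37GlueTorusCov (tblk torusComb)
open Literature.MathematicalPhysics.QuantumFieldTheory.Balaban1983to89.B9Thm37GlueTorusCovLevels (levelOp)
open B5TorusCover (UT Ctr ctrU)

variable {n ι : Type} [Fintype n] [DecidableEq n] [Fintype ι] [DecidableEq ι]
  {c : ℝ} {P : Submodule ℝ (Matrix n n ℂ)} {e : ι → Matrix n n ℂ}
  {d : ℕ} {N : Fin d → ℕ} [∀ i, NeZero (N i)] {J K : Type}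
  (S : J → ℕ) (hS : ∀ l, 1 ≤ S l) (hdivS : ∀ l i, S l ∣ N i) (lvl : K → J) (zc : (k : K) → Ctr N (S (lvl k)))
  (U : UT N × Fin d → (Matrix n n ℂ)ˣ)

/-! ## §1 The component background, the cell configuration and the in-cell unit plaquette -/

/-- **[our object] THE COMPONENT BACKGROUND** `Rm := adMat ∘ U`: the bond variable `U b ∈ U(N)` acting on the component family `e`
by the adjoint representation (`B9AdOrthogonal.adMat`). [folklore] -/
def adRm (c : ℝ) (e : ι → Matrix n n ℂ) (U : UT N × Fin d → (Matrix n n ℂ)ˣ) : UT N × Fin d → ι → ι → ℝ :=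
  fun b => adMat c e ((U b : (Matrix n n ℂ)ˣ) : Matrix n n ℂ)

omit [∀ i, NeZero (N i)] in
/-- **THE END's `hRm` FOR THE COMPONENT BACKGROUND** (orthonormal columns; `adMat_transpose_mul_self` BY NAME). [folklore] -/
theorem adRm_orth (hF : CompFamily c P e) (hU : ∀ b, U b ∈ unitaryUnits (Matrix n n ℂ)) :
    ∀ b i j, ∑ k, adRm c e U b k i * adRm c e U b k j = if i = j then (1 : ℝ) else 0 := by
  intro b i j
  have h := congrFun (congrFun (adMat_transpose_mul_self c P e hF.mem hF.compl hF.stable hF.orth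
    (mem_unitaryUnits.mp (hU b))) i) j
  rw [Matrix.mul_apply, Matrix.one_apply] at h
  simpa only [Matrix.transpose_apply, adRm] using h

/-- **[our object] CELL `k`'s BOND VARIABLES READ ON `ℤ^d`** (one b07 configuration for the one block `()`: at `z ∈ ℤ^d`, direction `i`,
the variable of the torus bond `(cellPt k (toOff z), i)` — honest on the box, the only place b07's in-block plaquette words visit).
[folklore] -/
def cellCfg (k : K) : Unit → Site d → Fin d → (Matrix n n ℂ)ˣ :=
  haveI := neZero_side S hS lvl k
  fun _ z i => U (cellPt S hS hdivS lvl zc k (toOff z), i)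

omit [Fintype ι] [DecidableEq ι] in
/-- **FILE 1's ONE-BLOCK CARRIER OF `adRm U` IS d4-p3's `Wad (cellCfg k)`** (`toOff ∘ emb = id`). [folklore] -/
theorem cellW_adRm (k : K) :
    cellW S hS hdivS lvl zc (adRm c e U) k = Wad (c := c) (e := e) (cellCfg S hS hdivS lvl zc U k) := by
  haveI := neZero_side S hS lvl k
  funext b
  rw [Wad_apply]
  simp only [cellW, adRm, cellCfg, toOff_emb]
  rfl

/-- **[our object] THE IN-CELL UNIT PLAQUETTE OF `U`** based at `x = cellPt k v` in the directions `κ, μ` (both successors inside the cell),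
chart form: `U(x,κ)·U(x⁺κ,μ)·U(x⁺μ,κ)⁻¹·U(x,μ)⁻¹` as a matrix. [folklore] -/
def cellPlaqU (k : K) (v : Box d (S (lvl k))) (κ μ : Fin d) (hκ : (v κ : ℕ) + 1 < S (lvl k))
    (hμ : (v μ : ℕ) + 1 < S (lvl k)) : Matrix n n ℂ :=
  ((U (cellPt S hS hdivS lvl zc k v, κ) * U (cellPt S hS hdivS lvl zc k (succ v κ hκ), μ) *
      (U (cellPt S hS hdivS lvl zc k (succ v μ hμ), κ))⁻¹ * (U (cellPt S hS hdivS lvl zc k v, μ))⁻¹ : (Matrix n n ℂ)ˣ) :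
    Matrix n n ℂ)

/-- **b07's PLAQUETTE HOLONOMY OF THE CELL CONFIGURATION IS THE IN-CELL UNIT PLAQUETTE** (`hol_plaqWord_eq`, `emb_succOff`,
`toOff_emb`). [folklore] -/
theorem hol_cellCfg_plaqWord (k : K) (v : Box d (S (lvl k))) (κ μ : Fin d) (hκ : (v κ : ℕ) + 1 < S (lvl k))
    (hμ : (v μ : ℕ) + 1 < S (lvl k)) :
    ((B7Prop1Explicit.hol (cellCfg S hS hdivS lvl zc U k ()) (emb v) (plaqWord κ μ) : (Matrix n n ℂ)ˣ) : Matrix n n ℂ) =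
      cellPlaqU S hS hdivS lvl zc U k v κ μ hκ hμ := by
  haveI := neZero_side S hS lvl k
  rw [hol_plaqWord_eq, ← emb_succOff v κ hκ, ← emb_succOff v μ hμ]
  simp only [cellCfg, toOff_emb, cellPlaqU]
  rfl

/-! ## §1b The plaquette hypothesis in b07's box currency (`PlaqIn` ∕ `pdevOn` — OUR row E7's functional) -/

omit [Fintype n] [DecidableEq n] [Fintype ι] [DecidableEq ι] [∀ i, NeZero (N i)] in
/-- The chart plaquette `(emb v; κ, μ)` with both successors inside the cell lies in b07's box `[0, S − 1]^d`. [folklore] -/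
theorem plaqIn_emb {M : ℕ} [NeZero M] (v : Box d M) (κ μ : Fin d) (hκ : (v κ : ℕ) + 1 < M) (hμ : (v μ : ℕ) + 1 < M)
    (hκμ : κ ≠ μ) : B7Prop1Local.PlaqIn 0 (CovariantPlateauBlocks.boxHi d M) (emb v, κ, μ) := by
  have hμ' : ((succOff v κ hκ) μ : ℕ) + 1 < M := by
    have : succOff v κ hκ μ = v μ := Function.update_of_ne hκμ.symm _ _
    rw [this]; exact hμ
  refine ⟨CovariantPlateauBlocks.emb_inBox v, ?_⟩
  have h : emb v + B7Prop1Explicit.e κ + B7Prop1Explicit.e μ = emb (succOff (succOff v κ hκ) μ hμ') := by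
    rw [emb_succOff, emb_succOff]
  simpa only [h] using CovariantPlateauBlocks.emb_inBox (succOff (succOff v κ hκ) μ hμ')

omit [Fintype ι] [DecidableEq ι] in
/-- **`hplaqU` FROM THE `PlaqIn` FORM**: if every unit plaquette of the cell configuration inside b07's box is within `α` of `1`, so is
every chart plaquette `cellPlaqU` (`hol_cellCfg_plaqWord`). [folklore] -/
theorem hplaqU_of_plaqIn (k : K) {α : ℝ}
    (h : haveI := neZero_side S hS lvl k
      ∀ p : Site d × Fin d × Fin d, B7Prop1Local.PlaqIn 0 (CovariantPlateauBlocks.boxHi d (S (lvl k))) p →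
        ‖((B7Prop1Explicit.hol (cellCfg S hS hdivS lvl zc U k ()) p.1 (plaqWord p.2.1 p.2.2) : (Matrix n n ℂ)ˣ) :
          Matrix n n ℂ) - 1‖ ≤ α) :
    ∀ (v : Box d (S (lvl k))) (κ μ : Fin d) (hκ : (v κ : ℕ) + 1 < S (lvl k)) (hμ : (v μ : ℕ) + 1 < S (lvl k)),
      κ ≠ μ → ‖cellPlaqU S hS hdivS lvl zc U k v κ μ hκ hμ - 1‖ ≤ α := by
  haveI := neZero_side S hS lvl k
  intro v κ μ hκ hμ hκμ
  rw [← hol_cellCfg_plaqWord]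
  exact h (emb v, κ, μ) (plaqIn_emb v κ μ hκ hμ hκμ)

omit [Fintype ι] [DecidableEq ι] in
/-- **`hplaqU` FROM OUR ROW E7's FUNCTIONAL**: `pdevOn 0 (S_k − 1) (cellCfg k ()) ≤ α` (b07's located plaquette deviation of the cell
configuration — the SHAPE of `h52locw`∕`h52loce`) gives `‖cellPlaqU − 1‖ ≤ α` on every chart plaquette (`le_pdevOn`; unitary matrices are
norm-one units, `CStarRing.norm_of_mem_unitary`). [folklore] -/
theorem hplaqU_of_pdevOn [Nonempty n] (hU : ∀ b, U b ∈ unitaryUnits (Matrix n n ℂ)) (k : K) {α : ℝ}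
    (h : haveI := neZero_side S hS lvl k
      B7Prop1Local.pdevOn 0 (CovariantPlateauBlocks.boxHi d (S (lvl k))) (cellCfg S hS hdivS lvl zc U k ()) ≤ α) :
    ∀ (v : Box d (S (lvl k))) (κ μ : Fin d) (hκ : (v κ : ℕ) + 1 < S (lvl k)) (hμ : (v μ : ℕ) + 1 < S (lvl k)),
      κ ≠ μ → ‖cellPlaqU S hS hdivS lvl zc U k v κ μ hκ hμ - 1‖ ≤ α := by
  haveI := neZero_side S hS lvl k
  have hU1 : ∀ z i, cellCfg S hS hdivS lvl zc U k () z i ∈ B7Prop1Explicit.U1 (Matrix n n ℂ) := fun z i => by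
    have hu : cellCfg S hS hdivS lvl zc U k () z i ∈ unitaryUnits (Matrix n n ℂ) := hU _
    have hu' := (unitaryUnits (Matrix n n ℂ)).inv_mem hu
    exact ⟨(CStarRing.norm_of_mem_unitary (mem_unitaryUnits.mp hu)).le,
      (CStarRing.norm_of_mem_unitary (mem_unitaryUnits.mp hu')).le⟩
  refine hplaqU_of_plaqIn S hS hdivS lvl zc U k (fun p hp => ?_)
  exact (B7Prop1Local.le_pdevOn hU1 hp).trans h

/-! ## §2 File 1's plaquette hypothesis and THE END's `hgauge` for the component background -/

/-- **FILE 1's `hplaq` FOR `adRm U` FROM THE UNIT PLAQUETTES, FACTOR 2** (`AdjointCarrierWiringEnd.hplaqW_Wad_of_plaq` BY NAME through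
`cellW_adRm` and file 1's `plaqW_cellW`). [folklore] -/
theorem hplaq_adRm_of_plaqU (hF : CompFamily c P e) (hU : ∀ b, U b ∈ unitaryUnits (Matrix n n ℂ)) (k : K) {α : ℝ}
    (hplaqU : ∀ (v : Box d (S (lvl k))) (κ μ : Fin d) (hκ : (v κ : ℕ) + 1 < S (lvl k)) (hμ : (v μ : ℕ) + 1 < S (lvl k)),
      κ ≠ μ → ‖cellPlaqU S hS hdivS lvl zc U k v κ μ hκ hμ - 1‖ ≤ α)
    (v : Box d (S (lvl k))) (κ μ : Fin d) (hκ : (v κ : ℕ) + 1 < S (lvl k)) (hμ : (v μ : ℕ) + 1 < S (lvl k)) (hκμ : κ ≠ μ) :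
    ‖cpxHom (cellPlaq S hS hdivS lvl zc (adRm c e U) k v κ μ hκ hμ) - 1‖ ≤ 2 * α := by
  haveI := neZero_side S hS lvl k
  rw [← plaqW_cellW, cellW_adRm]
  refine hplaqW_Wad_of_plaq hF (cellCfg S hS hdivS lvl zc U k) (fun _ z i => hU _) (fun _ v κ μ hκ hμ hne => ?_)
    () v κ μ hκ hμ hκμ
  rw [hol_cellCfg_plaqWord]
  exact hplaqU v κ μ hκ hμ hne

/-- **THE END's `hgauge k` FOR THE COMPONENT BACKGROUND** with `ε_k = d·(S_k − 1)·(2α)` from `‖cellPlaqU − 1‖ ≤ α` (file 1's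
`hgauge_of_plaquettes` at `Rm := adRm U`; `[Nonempty ι]`). [folklore] -/
theorem hgauge_adRm_of_plaqU [Nonempty ι] (hF : CompFamily c P e) (hU : ∀ b, U b ∈ unitaryUnits (Matrix n n ℂ)) (k : K)
    {α : ℝ} (hα : 0 ≤ α)
    (hplaqU : ∀ (v : Box d (S (lvl k))) (κ μ : Fin d) (hκ : (v κ : ℕ) + 1 < S (lvl k)) (hμ : (v μ : ℕ) + 1 < S (lvl k)),
      κ ≠ μ → ‖cellPlaqU S hS hdivS lvl zc U k v κ μ hκ hμ - 1‖ ≤ α)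
    (v : Box d (S (lvl k))) (i : Fin d) (hv : (v i : ℕ) + 1 < S (lvl k)) (u : ι → ℝ) :
    ∑ a', (∑ j, (hol (adRm c e U) (cellGauge S hS hdivS lvl zc (adRm c e U) (adRm_orth U hF hU) k)
        (fun v i _ => (cellPt S hS hdivS lvl zc k v, i)) v i hv a' j - if a' = j then 1 else 0) * u j) ^ 2 ≤
      (d * ((S (lvl k) : ℝ) - 1) * (2 * α)) ^ 2 * ∑ j, u j ^ 2 :=
  hgauge_of_plaquettes S hS hdivS lvl zc (adRm c e U) (adRm_orth U hF hU) k (by positivity)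
    (fun v κ μ hκ hμ hne => hplaq_adRm_of_plaqU S hS hdivS lvl zc U hF hU k hplaqU v κ μ hκ hμ hne) v i hv u

/-! ## §3 THE END FIRED ON THE ADJOINT CARRIER -/

/-- **k-UNIFORM DECAY FOR A PLAQUETTE-SMALL `U(N)`-VALUED BACKGROUND IN COMPONENTS (MODEL; file 1's `decay_levelOp_cov_of_plaquettes`
at `Rm := adRm U`, `α_k := 2α_k^U`).**  Field hypotheses: `U` unitary-valued, every in-cell unit plaquette within `α_k^U` of `1`
(operator norm), `0 ≤ α_k^U`, `S_k²·(2α_k^U) ≤ α₀`; `θ = 8d⁴α₀²`; conclusion token-identical to `MultiscaleDecay.decay_levelOp_cov`'s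
for `Rm := adRm U` at that `θ`. [folklore] -/
theorem decay_levelOp_cov_of_plaquettesU [NeZero d] [Fintype J] [Fintype K] [Nonempty ι] (hF : CompFamily c P e)
    (hU : ∀ b, U b ∈ unitaryUnits (Matrix n n ℂ))
    (hdisj : ∀ k k' v v', cellPt S hS hdivS lvl zc k v = cellPt S hS hdivS lvl zc k' v' → k = k')
    (hcover : ∀ x : UT N, ∃ k, ∃ v : Box d (S (lvl k)), cellPt S hS hdivS lvl zc k v = x)
    (a : J → ℝ) (ha : ∀ j, 0 ≤ a j) (ω : J → UT N → ℝ)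
    (hsupp : ∀ l x, ω l (ctrU N (S l) (tblk (hS l) (hdivS l) x)) ≠ 0 → ∃ k v, lvl k = l ∧ cellPt S hS hdivS lvl zc k v = x)
    {amin amax : ℝ} (hamin : 0 ≤ amin) (hamax : 0 ≤ amax)
    (hscale_lo : ∀ k, amin / (S (lvl k) : ℝ) ^ 2 ≤ a (lvl k) * ω (lvl k) (ctrU N (S (lvl k)) (zc k)) ^ 2 * (S (lvl k) : ℝ) ^ d)
    (hscale_hi : ∀ k, a (lvl k) * ω (lvl k) (ctrU N (S (lvl k)) (zc k)) ^ 2 * (S (lvl k) : ℝ) ^ d ≤ amax / (S (lvl k) : ℝ) ^ 2)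
    (cw : UT N × Fin d → ℝ) {cmin cmax : ℝ} (hcmin : 0 < cmin) (hc_lo : ∀ b, cmin ≤ |cw b|) (hc_hi : ∀ b, |cw b| ≤ cmax)
    (αU : K → ℝ) (hαU : ∀ k, 0 ≤ αU k) {α₀ : ℝ} (hαS : ∀ k, (S (lvl k) : ℝ) ^ 2 * (2 * αU k) ≤ α₀)
    (hplaqU : ∀ k (v : Box d (S (lvl k))) (κ μ : Fin d) (hκ : (v κ : ℕ) + 1 < S (lvl k)) (hμ : (v μ : ℕ) + 1 < S (lvl k)),
      κ ≠ μ → ‖cellPlaqU S hS hdivS lvl zc U k v κ μ hκ hμ - 1‖ ≤ αU k)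
    {κ : ℝ} (hκ0 : 0 ≤ κ) (hκ1 : κ ≤ 1)
    (hμ : 0 < (1 - 8 * (d : ℝ) ^ 4 * α₀ ^ 2) * min (cmin ^ 2 / (4 * d)) (amin / 4) - 2 * d * cmax ^ 2 * κ ^ 2 -
      amax * (Real.exp (2 * d * κ) - 1))
    (p q : UT N × ι) :
    IsUnit (levelOp bsrc btgt cw (adRm c e U) (fun l x => ctrU N (S l) (tblk (hS l) (hdivS l) x))
        (fun l x => ω l (ctrU N (S l) (tblk (hS l) (hdivS l) x))) (fun l x => (torusComb (hS l) (hdivS l)).tr (adRm c e U) x) a) ∧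
      |Ring.inverse (levelOp bsrc btgt cw (adRm c e U) (fun l x => ctrU N (S l) (tblk (hS l) (hdivS l) x))
          (fun l x => ω l (ctrU N (S l) (tblk (hS l) (hdivS l) x))) (fun l x => (torusComb (hS l) (hdivS l)).tr (adRm c e U) x) a)
          (Pi.single q 1) p| ≤
        Real.exp (-(κ * sdist bsrc btgt (siteScale S hS hdivS lvl zc hcover) p.1 q.1)) *
          ((siteScale S hS hdivS lvl zc hcover p.1 : ℝ) * (siteScale S hS hdivS lvl zc hcover q.1 : ℝ)) /
          ((1 - 8 * (d : ℝ) ^ 4 * α₀ ^ 2) * min (cmin ^ 2 / (4 * d)) (amin / 4) - 2 * d * cmax ^ 2 * κ ^ 2 -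
            amax * (Real.exp (2 * d * κ) - 1)) :=
  decay_levelOp_cov_of_plaquettes S hS hdivS lvl zc (adRm c e U) (adRm_orth U hF hU) hdisj hcover a ha ω hsupp hamin hamax
    hscale_lo hscale_hi cw hcmin hc_lo hc_hi (fun k => 2 * αU k) (fun k => by have := hαU k; positivity) hαS
    (fun k v κ μ hκ hμ hne => hplaq_adRm_of_plaqU S hS hdivS lvl zc U hF hU k (hplaqU k) v κ μ hκ hμ hne) hκ0 hκ1 hμ p q

/-! ## §4 Non-vacuity (crew rule G-1) -/

/-- su(2) in the Pauli components (`compFamily_pauli`), the FLAT `U(2)` field on the one-cell d = 2 torus `(ℤ∕2ℤ)²`: the unit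
plaquettes are `1·1·1⁻¹·1⁻¹ = 1` (`α = 0`), so file 1's `hplaq` holds for `adRm` with `2·0` — every hypothesis (`CompFamily`,
`unitaryUnits`-valuedness) discharged, `hplaq_adRm_of_plaqU` FIRED. [folklore] -/
example (v : Box 2 2) (κ μ : Fin 2) (hκ : (v κ : ℕ) + 1 < 2) (hμ : (v μ : ℕ) + 1 < 2) (hκμ : κ ≠ μ) :
    ‖cpxHom (cellPlaq (fun _ : Unit => 2) (fun _ => one_le_two) (fun _ _ => dvd_rfl) (fun _ : Unit => ())
      (fun _ _ => ⟨0, B5TorusCover.one_le_nC _ _⟩)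
      (adRm (1 / 2 : ℝ) pauli (fun _ : UT (fun _ : Fin 2 => 2) × Fin 2 => (1 : (Matrix (Fin 2) (Fin 2) ℂ)ˣ))) () v κ μ hκ hμ) - 1‖ ≤
      2 * 0 :=
  hplaq_adRm_of_plaqU (fun _ : Unit => 2) (fun _ => one_le_two) (fun _ _ => dvd_rfl) (fun _ : Unit => ())
    (fun _ _ => ⟨0, B5TorusCover.one_le_nC _ _⟩) _ compFamily_pauli (fun _ => (unitaryUnits _).one_mem) ()
    (fun v κ μ hκ hμ _ => by simp [cellPlaqU]) v κ μ hκ hμ hκμ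

end Summit.QuantumFields.BalabanUV.T4Continuum.ShellMeasureCellGaugeFromPlaquettesAd

end
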